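import Literature.Analysis.FluidPDE.CheskidovShvydkoy
import Literature.Analysis.FluidPDE.CheskidovShvydkoyRegular
import HarnessLib

/-!
# Cheskidov–Shvydkoy's Thm. 3.1 from Lemma 3.2, Leray's continuation theorem and ns.S07

Analysis/FluidPDE proofs file (serves the discharge of `Literature.Analysis.FluidPDE.cheskidov_shvydkoy`, ns.S31;
pure proofs, no new definitions). Assembles the reduction of the accepted
`NS.cheskidov_shvydkoy` (Cheskidov–Shvydkoy, Arch. Ration. Mech. Anal. 195 (2010), Thm. 3.1) to
the named facts `NS.cheskidov_shvydkoy_dyadic_regular` (their Lemma 3.2),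
`NS.leray_continuation_H1` (their Thm. 2.4, "Leray", case `s = 1`) of
`CheskidovShvydkoyRegular.lean` and the accepted `NS.ladyzhenskaya_prodi_serrin` (ns.S07),
following the printed proof of Thm. 3.1 (p. 6 of arXiv:0708.3067):

* `NS.isH1RegularOn_of_jumps_lt`, `NS.cheskidov_shvydkoy_inhom_of_regular` : Lemma 3.2 +
  Thm. 2.4 ⟹ `H¹`-regularity on `(0, T]` under the jump hypothesis of Thm. 3.1 (the paper's
  literal conclusion), and with ns.S07 Thm. 3.1 in the house form
  (`NS.cheskidov_shvydkoy_inhom`, inhomogeneous `B^{-1}_{∞,∞}`): for every `β ∈ (0, T]` the jump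
  hypothesis gives `t₁ < β` with
  `limsup_q sup_{(t₁,β)} λ_q⁻¹‖u_q‖_∞ < 2 (c/2) ν`
  (`NS.exists_limsup_biSup_lpBlockWeight_lt_of_isLerayHopfOn`, `CheskidovShvydkoy.lean`);
  restarting `u` at a good time `s ∈ (t₁, β)`
  (`Fluid.IsLerayHopfOn.exists_isLerayHopfOn_restart_Ioo`, via `LerayHopfRestart.lean`) and
  applying Lemma 3.2 to `u(· + s)` on `[0, β - s]` gives continuity of `‖u(t)‖_{H¹}` on
  `(s, β]`, so `limsup_{t → β⁻} ‖u(t)‖_{H¹} = ‖u(β)‖_{H¹} < ∞`;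
  Thm. 2.4 then gives `H¹`-regularity on `(0, T]`, and ns.S07 the classical representative
  (`NS.classical_of_isH1RegularOn`, `CheskidovShvydkoyRegular.lean`);
* `NS.cheskidov_shvydkoy_of_regular` : the same three facts ⟹ the accepted
  `NS.cheskidov_shvydkoy` (through `NS.cheskidov_shvydkoy_of_inhom`);
* `NS.cheskidov_shvydkoy_dyadic_of_regular` : Lemma 3.2 as printed + ns.S07 ⟹ its house form
  `NS.cheskidov_shvydkoy_dyadic`.

## References

* A. Cheskidov, R. Shvydkoy, Arch. Ration. Mech. Anal. 195 (2010) 159–169 = arXiv:0708.3067,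
  Thm. 3.1 and its proof (p. 6), Lemma 3.2, Thm. 2.4.
-/

noncomputable section

open MeasureTheory TopologicalSpace Set Function Filter Topology
open scoped ENNReal NNReal SchwartzMap

namespace Literature.Analysis.FluidPDE

/-! ## Thm. 3.1 from Lemma 3.2, Thm. 2.4 and ns.S07 -/

section Main

/-- **The house form of Lemma 3.2 from the printed one** (`cheskidov_shvydkoy_dyadic_regular` and
ns.S07 give `cheskidov_shvydkoy_dyadic`, same constant): the printed conclusion "`u` regular on
`(0, T]`" is `H¹`-regularity, and `classical_of_isH1RegularOn` supplies the classical
representative on `Ioc 0 T`. [cite: CheskidovShvydkoy2010, Lemma 3.2] -/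
theorem cheskidov_shvydkoy_dyadic_of_regular (h32 : cheskidov_shvydkoy_dyadic_regular)
    (hLPS : ladyzhenskaya_prodi_serrin) : cheskidov_shvydkoy_dyadic := by
  obtain ⟨c, hc, H⟩ := h32
  exact ⟨c, hc, fun ν T hν hT u₀ u U hLH hU hdy =>
    classical_of_isH1RegularOn hLPS hν hT hLH (H ν T hν hT u₀ u U hLH hU hdy)⟩

/-- **`H¹`-regularity from small `B^{-1}_{∞,∞}` jumps** — the core of Cheskidov–Shvydkoy's proof
of their Thm. 3.1 (arXiv:0708.3067, p. 6), with the paper's own conclusion ("regular on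
`(0, T]`" = `‖u(t)‖_{H¹}` continuous on `(0, T]`, `Fluid.IsH1RegularOn`), from the content of
Lemma 3.2 with constant `c` (hypothesis `H32`, the body of `cheskidov_shvydkoy_dyadic_regular`)
and Thm. 2.4 (`s = 1`, `leray_continuation_H1`), for jumps `< (c/2) ν`. Let `β ∈ (0, T]`. The
jump hypothesis at `β` gives `t₁ < β` with
`limsup_j sup_{s ∈ (t₁,β)} 2^{-j}‖Δ̇_j U(s)‖_∞ < 2 (c/2) ν = cν`
(`exists_limsup_biSup_lpBlockWeight_lt_of_isLerayHopfOn`: the dyadic tails of a Leray–Hopf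
solution vanish at a.e. time, replacing the paper's "`u(t) ∈ C^∞` on an interval of
regularity, hence `φ(t) = 0`"). Restart `u` at a good time `s ∈ (t₁, β)`
(`Fluid.IsLerayHopfOn.exists_isLerayHopfOn_restart_Ioo`): `u(· + s)` is Leray–Hopf on
`[0, β - s]` with slice distributions `U(· + s)` and satisfies the hypothesis of Lemma 3.2
there, so it is `H¹`-regular on `(0, β - s]`, i.e. `‖u(t)‖_{H¹}` is continuous on `(s, β]`
("that lemma implies regularity of `u(t)` on `(α, β]`, i.e., continuity of `‖u(t)‖_{H¹}` on
`(α, β]`"); in particular `limsup_{t → β⁻} ‖u(t)‖²_{H¹} = ‖u(β)‖²_{H¹} < ∞`. This being true for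
every `β`, Thm. 2.4 gives `H¹`-regularity on `(0, T]` ("Hence `u(t)` is regular on `(0,T]` in
view of Theorem 2.4"). [cite: CheskidovShvydkoy2010, Thm. 3.1 (proof, p. 6)] -/
theorem isH1RegularOn_of_jumps_lt {c : ℝ}
    (H32 : ∀ (ν T : ℝ), 0 < ν → 0 < T →
      ∀ (u₀ : EuclideanSpace ℝ (Fin 3) → EuclideanSpace ℝ (Fin 3))
      (u : ℝ → EuclideanSpace ℝ (Fin 3) → EuclideanSpace ℝ (Fin 3))
      (U : ℝ → 𝓢'(EuclideanSpace ℝ (Fin 3), EuclideanSpace ℂ (Fin 3))),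
      FluidPDE.IsLerayHopfOn T ν 0 u₀ u →
      (∀ t ∈ Icc 0 T, IsDistributionOf (u t) (U t)) →
      limsup (fun j : ℕ => ⨆ t ∈ Ioo 0 T, FunctionSpaces.lpBlockWeight (-1) ∞ (U t) (j : ℤ)) atTop <
        ENNReal.ofReal (c * ν) →
      FluidPDE.IsH1RegularOn (Ioc 0 T) u)
    (h24 : leray_continuation_H1) {ν T : ℝ} (hν : 0 < ν) (hT : 0 < T)
    {u₀ : EuclideanSpace ℝ (Fin 3) → EuclideanSpace ℝ (Fin 3)}
    {u : ℝ → EuclideanSpace ℝ (Fin 3) → EuclideanSpace ℝ (Fin 3)}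
    {U : ℝ → 𝓢'(EuclideanSpace ℝ (Fin 3), EuclideanSpace ℂ (Fin 3))}
    (hLH : FluidPDE.IsLerayHopfOn T ν 0 u₀ u)
    (hU : ∀ t ∈ Icc 0 T, IsDistributionOf (u t) (U t))
    (hjump : (⨆ t ∈ Ioc 0 T, limsup (fun t₀ => FunctionSpaces.eBesovNorm (-1) ∞ ∞ (U t - U t₀)) (𝓝[<] t)) <
      ENNReal.ofReal (c / 2 * ν)) :
    FluidPDE.IsH1RegularOn (Ioc 0 T) u := by
  refine h24 ν T hν hT u₀ u hLH fun α β hα hαβ hβT _ => ?_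
  have hβ : β ∈ Ioc 0 T := ⟨hα.trans_lt hαβ, hβT⟩
  -- the jump at `β`
  have hjβ : limsup (fun t₀ => FunctionSpaces.eBesovNorm (-1) ∞ ∞ (U β - U t₀)) (𝓝[<] β) <
      ENNReal.ofReal (c / 2 * ν) := by
    refine lt_of_le_of_lt ?_ hjump
    exact le_iSup₂_of_le (f := fun t (_ : t ∈ Ioc 0 T) =>
      limsup (fun t₀ => FunctionSpaces.eBesovNorm (-1) ∞ ∞ (U t - U t₀)) (𝓝[<] t)) β hβ le_rfl
  obtain ⟨t₁, ht₁, hlim⟩ := exists_limsup_biSup_lpBlockWeight_lt_of_isLerayHopfOn hLH hU hβ hjβ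
  -- restart at a good time `s ∈ (t₁, β)`
  obtain ⟨s, hs, hLHs⟩ := hLH.exists_isLerayHopfOn_restart_Ioo hν.le ht₁.1 ht₁.2 hβ.2
  have hβs : 0 < β - s := sub_pos.2 hs.2
  have hs0 : 0 ≤ s := ht₁.1.trans hs.1.le
  have hLHs' : FluidPDE.IsLerayHopfOn (β - s) ν 0 (u s) (fun t => u (t + s)) :=
    hLHs.of_le (by linarith [hβ.2])
  have hUs : ∀ t ∈ Icc 0 (β - s), IsDistributionOf (u (t + s)) (U (t + s)) := fun t ht =>
    hU (t + s) ⟨by linarith [ht.1], by linarith [ht.2, hβ.2]⟩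
  -- the hypothesis of Lemma 3.2 for the restart
  have hdy : limsup (fun j : ℕ => ⨆ t ∈ Ioo 0 (β - s), FunctionSpaces.lpBlockWeight (-1) ∞ (U (t + s)) (j : ℤ))
      atTop < ENNReal.ofReal (c * ν) := by
    have hle : ∀ j : ℕ, (⨆ t ∈ Ioo 0 (β - s), FunctionSpaces.lpBlockWeight (-1) ∞ (U (t + s)) (j : ℤ)) ≤
        ⨆ s' ∈ Ioo t₁ β, FunctionSpaces.lpBlockWeight (-1) ∞ (U s') (j : ℤ) := fun j =>
      iSup₂_le fun t ht => le_iSup₂_of_le (f := fun s' (_ : s' ∈ Ioo t₁ β) =>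
        FunctionSpaces.lpBlockWeight (-1) ∞ (U s') (j : ℤ)) (t + s) ⟨by linarith [ht.1, hs.1], by linarith [ht.2]⟩
        le_rfl
    calc limsup (fun j : ℕ => ⨆ t ∈ Ioo 0 (β - s), FunctionSpaces.lpBlockWeight (-1) ∞ (U (t + s)) (j : ℤ)) atTop
        ≤ limsup (fun j : ℕ => ⨆ s' ∈ Ioo t₁ β, FunctionSpaces.lpBlockWeight (-1) ∞ (U s') (j : ℤ)) atTop :=
          limsup_le_limsup (Eventually.of_forall hle)
      _ < 2 * ENNReal.ofReal (c / 2 * ν) := hlim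
      _ = ENNReal.ofReal (c * ν) := by
          rw [← ENNReal.ofReal_ofNat 2, ← ENNReal.ofReal_mul (by norm_num)]
          congr 1
          ring
  have hregs : FluidPDE.IsH1RegularOn (Ioc 0 (β - s)) (fun t => u (t + s)) :=
    H32 ν (β - s) hν hβs (u s) (fun t => u (t + s)) (fun t => U (t + s)) hLHs' hUs hdy
  -- the `H¹` norm is continuous from the left at `β`, with a finite value
  have hcont : ContinuousWithinAt (fun t => FluidPDE.eH1NormSq (u (t + s))) (Ioc 0 (β - s)) (β - s) :=
    hregs.2 (β - s) ⟨hβs, le_rfl⟩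
  have hfin : FluidPDE.eH1NormSq (u β) < ∞ := by
    have := hregs.1 (β - s) ⟨hβs, le_rfl⟩
    simpa only [sub_add_cancel] using this
  have hφ : Tendsto (fun t => t - s) (𝓝[<] β) (𝓝[Ioc 0 (β - s)] (β - s)) := by
    refine tendsto_nhdsWithin_iff.2 ⟨?_, ?_⟩
    · exact ((continuous_id.sub continuous_const).tendsto β).mono_left nhdsWithin_le_nhds
    · filter_upwards [Ioo_mem_nhdsLT hs.2] with t ht
      exact ⟨by linarith [ht.1], by linarith [ht.2]⟩
  have htend : Tendsto (fun t => FluidPDE.eH1NormSq (u t)) (𝓝[<] β) (𝓝 (FluidPDE.eH1NormSq (u β))) := by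
    have h := hcont.tendsto.comp hφ
    simp only [Function.comp_def, sub_add_cancel] at h
    exact h
  rw [htend.limsup_eq]
  exact hfin

/-- **Cheskidov–Shvydkoy's Thm. 3.1 (as printed, `cheskidov_shvydkoy_inhom`) from Lemma 3.2,
Thm. 2.4 (`s = 1`) and ns.S07**, with the constant `c/2` if Lemma 3.2 holds with `c`:
`H¹`-regularity on `(0, T]` by `isH1RegularOn_of_jumps_lt` (the printed proof, p. 6), then the
classical representative by ns.S07 (`classical_of_isH1RegularOn`).
[cite: CheskidovShvydkoy2010, Thm. 3.1 (proof, p. 6)] -/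
theorem cheskidov_shvydkoy_inhom_of_regular (h32 : cheskidov_shvydkoy_dyadic_regular)
    (h24 : leray_continuation_H1) (hLPS : ladyzhenskaya_prodi_serrin) :
    cheskidov_shvydkoy_inhom := by
  obtain ⟨c, hc, H32⟩ := h32
  exact ⟨c / 2, by positivity, fun ν T hν hT u₀ u U hLH hU hjump =>
    classical_of_isH1RegularOn hLPS hν hT hLH
      (isH1RegularOn_of_jumps_lt H32 h24 hν hT hLH hU hjump)⟩

/-- **The accepted ns.S31 (`NS.cheskidov_shvydkoy`) from Lemma 3.2, Thm. 2.4 (`s = 1`) and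
ns.S07**: `cheskidov_shvydkoy_inhom_of_regular` followed by the comparison of the inhomogeneous
and homogeneous `B^{-1}_{∞,∞}` norms of `L²` increments (`cheskidov_shvydkoy_of_inhom`,
`CheskidovShvydkoy.lean`). What remains for `cheskidov_shvydkoy_holds` are the named facts
`cheskidov_shvydkoy_dyadic_regular` (CS Lemma 3.2), `leray_continuation_H1` (CS Thm. 2.4) and
`ladyzhenskaya_prodi_serrin` (ns.S07). [cite: CheskidovShvydkoy2010, Thm. 3.1] -/
theorem cheskidov_shvydkoy_of_regular (h32 : cheskidov_shvydkoy_dyadic_regular)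
    (h24 : leray_continuation_H1) (hLPS : ladyzhenskaya_prodi_serrin) : cheskidov_shvydkoy :=
  cheskidov_shvydkoy_of_inhom (cheskidov_shvydkoy_inhom_of_regular h32 h24 hLPS)

end Main

end Literature.Analysis.FluidPDE

end
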